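import Literature.Computability.QuantumComplexity.OracleXorBlock
import Literature.Computability.Cryptography.KitaevBlockEmbedded
import HarnessLib

/-!
# Oracle-answered XOR blocks at the register level

Topic `Literature/Computability/QuantumComplexity`; sequel of `OracleXorBlock.lean` (a list of oracle
gates with pairwise un-queried, distinct targets acts on a basis state as the classical map `run`,
each target XOR-ed with the oracle's answer to its query; the placement `xorEmb hdr src t`: header
wires, source wires, target). Support for the discharge of `VanDamSeroussi2002_gaussSumPhase_qsolvable`,
whose gadget-free circuit performs EVERY classical step as such a block writing the bits of one value
into a clean register (Bennett–Bernstein–Brassard–Vazirani 1997, Cor. 4.15: garbage-free oracle XOR)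
and erases it by asking again (Bennett 1973). Here the `n` gates of a block share the source wires
`src`, gate `i` reads its own header `hdr i` (the constant wires spelling its query prefix) and answers
on `dst i`:

* `OracleXor.XBlock` (the data, with the geometric side conditions), `XBlock.gates`, `XBlock.disjoint`;
* **`XBlock.run_apply_dst` / `run_apply_of_not_dst`** — the block XORs `dst i` with the answer to
  `ofFn (x ∘ hdr i) ++ ofFn (x ∘ src)` and touches nothing else;
* **`XBlock.run_eq_writeB_of_clean`** — on a label with clean targets whose answers are the bits
  `v i`, the block WRITES `v` on `dst` (`QFTQubits.writeB`); **`XBlock.run_eq_writeB_of_written`** — on a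
  label whose targets hold exactly the answers, the block CLEARS them.

Everything is proved; the definitions have bodies; no named fact.

## References

* C. H. Bennett, E. Bernstein, G. Brassard, U. Vazirani, SIAM J. Comput. 26 (1997), Cor. 4.15 [BennettBernsteinBrassardVazirani1997].
* C. H. Bennett, *Logical reversibility of computation*, IBM J. Res. Dev. 17 (1973), §2 [Bennett1973].
-/

namespace Literature.Computability.QuantumComplexity

open Cryptography QFTQubits

namespace OracleXor

variable {N : ℕ}

/-- **An oracle XOR block**: `n` gates sharing the `s` source wires; gate `i` reads the `hl i` header
wires `hdr i`, then the sources, and answers on `dst i`; headers and sources avoid the targets.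
[cite: BennettBernsteinBrassardVazirani1997, Cor. 4.15] -/
structure XBlock (N : ℕ) where
  /-- number of gates (bits written) -/
  n : ℕ
  /-- header lengths -/
  hl : Fin n → ℕ
  /-- header wires of gate `i` -/
  hdr : (i : Fin n) → (Fin (hl i) ↪ Fin N)
  /-- number of source wires -/
  s : ℕ
  /-- the shared source wires -/
  src : Fin s ↪ Fin N
  /-- the target wires -/
  dst : Fin n ↪ Fin N
  /-- headers avoid sources -/
  hhs : ∀ i a b, hdr i a ≠ src b
  /-- headers avoid targets -/
  hht : ∀ i a j, hdr i a ≠ dst j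
  /-- sources avoid targets -/
  hst : ∀ b j, src b ≠ dst j

namespace XBlock

variable (B : XBlock N)

/-- Gate `i` of the block. [folklore] -/
def gate (i : Fin B.n) : OGate N :=
  ⟨B.hl i + B.s, xorEmb (B.hdr i) B.src (B.dst i) (B.hhs i) (fun a => B.hht i a i) (fun b => B.hst b i)⟩

/-- The gates of the block, in order. [folklore] -/
def gates : List (OGate N) := List.ofFn B.gate

/-- The target of gate `i` is `dst i`. [folklore] -/
theorem target_gate (i : Fin B.n) : (B.gate i).target = B.dst i := target_xorEmb _ _ _ (B.hhs i) (fun a => B.hht i a i) (fun b => B.hst b i)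

/-- The query of gate `i` on a label: header bits then source bits. [folklore] -/
theorem queryOf_gate (i : Fin B.n) (x : QReg N) : queryOf (B.gate i).2 x = List.ofFn (x ∘ B.hdr i) ++ List.ofFn (x ∘ B.src) :=
  queryOf_xorEmb _ _ _ (B.hhs i) (fun a => B.hht i a i) (fun b => B.hst b i) x

/-- Membership in the gate list. [folklore] -/
theorem mem_gates_iff {g : OGate N} : g ∈ B.gates ↔ ∃ i, B.gate i = g := by
  rw [gates, List.mem_ofFn]

/-- No target is queried. [folklore] -/
theorem dst_not_mem_queries (i j : Fin B.n) : B.dst j ∉ (B.gate i).queries := by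
  rw [gate, mem_queries_xorEmb_iff]
  rintro (⟨a, ha⟩ | ⟨b, hb⟩)
  · exact B.hht i a j ha
  · exact B.hst b j hb

/-- **The block is disjoint**: distinct targets, none queried. [folklore] -/
theorem disjoint : Disjoint B.gates := by
  refine ⟨?_, fun g hg g' hg' => ?_⟩
  · rw [gates, List.map_ofFn, List.nodup_ofFn]
    intro i j h
    have h' : (B.gate i).target = (B.gate j).target := h
    rw [target_gate, target_gate] at h'
    exact B.dst.injective h'
  · obtain ⟨i, rfl⟩ := (B.mem_gates_iff).1 hg'
    obtain ⟨j, rfl⟩ := (B.mem_gates_iff).1 hg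
    rw [target_gate]
    exact B.dst_not_mem_queries i j

/-- **Off the targets the block does nothing.** [folklore] -/
theorem run_apply_of_not_dst (A : Language Bool) (x : QReg N) {w : Fin N} (hw : ∀ i, w ≠ B.dst i) : run A B.gates x w = x w :=
  run_apply_of_notTarget A B.gates x fun g hg => by
    obtain ⟨i, rfl⟩ := (B.mem_gates_iff).1 hg
    rw [target_gate]; exact hw i

/-- **On target `i` the block XORs the answer to `header ++ sources`.** [cite: BennettBernsteinBrassardVazirani1997, Cor. 4.15] -/
theorem run_apply_dst (A : Language Bool) (x : QReg N) (i : Fin B.n) :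
    run A B.gates x (B.dst i) = (x (B.dst i) ^^ A.boolIndicator (List.ofFn (x ∘ B.hdr i) ++ List.ofFn (x ∘ B.src))) := by
  have h := run_apply_target A B.gates B.disjoint x (B.gate i) ((B.mem_gates_iff).2 ⟨i, rfl⟩)
  rwa [target_gate, queryOf_gate] at h

/-- **Writing**: on a label with clean targets, if the oracle answers the bits `v i`, the block writes
`v` on the targets. [cite: BennettBernsteinBrassardVazirani1997, Cor. 4.15] -/
theorem run_eq_writeB_of_clean (A : Language Bool) (x : QReg N) (v : Fin B.n → Bool)
    (hclean : ∀ i, x (B.dst i) = false)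
    (hans : ∀ i, A.boolIndicator (List.ofFn (x ∘ B.hdr i) ++ List.ofFn (x ∘ B.src)) = v i) :
    run A B.gates x = writeB B.dst x v := by
  refine (KitaevEmb.eq_writeB_iff B.dst x _ v).2 ⟨fun w hw => ?_, funext fun i => ?_⟩
  · exact B.run_apply_of_not_dst A x fun i h => hw ⟨i, h.symm⟩
  · show run A B.gates x (B.dst i) = v i
    rw [B.run_apply_dst, hclean i, Bool.false_xor, hans i]

/-- **Erasing**: on a label whose targets hold exactly the answers, the block clears them.
[cite: Bennett1973, §2] -/
theorem run_eq_writeB_of_written (A : Language Bool) (x : QReg N)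
    (hans : ∀ i, A.boolIndicator (List.ofFn (x ∘ B.hdr i) ++ List.ofFn (x ∘ B.src)) = x (B.dst i)) :
    run A B.gates x = writeB B.dst x (fun _ => false) := by
  refine (KitaevEmb.eq_writeB_iff B.dst x _ _).2 ⟨fun w hw => ?_, funext fun i => ?_⟩
  · exact B.run_apply_of_not_dst A x fun i h => hw ⟨i, h.symm⟩
  · show run A B.gates x (B.dst i) = false
    rw [B.run_apply_dst, hans i, Bool.xor_self]

/-- The number of gates. [folklore] -/
theorem length_gates : B.gates.length = B.n := by rw [gates, List.length_ofFn]

end XBlock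

end OracleXor

end Literature.Computability.QuantumComplexity
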